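import Summits.SmoothPoincare4.SmoothPoincare4.Theorems.SymplecticOrigamiGromovRecognitionRelEndClassCount
import Summits.SmoothPoincare4.SmoothPoincare4.Theorems.SymplecticOrigamiGromovRecognitionRelEndCaseALeaf
import Summits.SmoothPoincare4.SmoothPoincare4.Theorems.SymplecticOrigamiGromovRecognitionRelEndWindLinAlg
import Summits.SmoothPoincare4.SmoothPoincare4.Theorems.SymplecticOrigamiGromovRecognitionRelEndLeafClopen
import Summits.SmoothPoincare4.SmoothPoincare4.Theorems.SymplecticOrigamiGromovRecognitionRelEndGluedBasics
import Summits.SmoothPoincare4.SmoothPoincare4.Theorems.SymplecticOrigamiGromovRecognitionRelEndLeafSwap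
import Summits.SmoothPoincare4.SmoothPoincare4.Theorems.SymplecticOrigamiGromovRecognitionRelEndLeafCoordinate
import Summits.SmoothPoincare4.SmoothPoincare4.Theorems.SymplecticOrigamiGromovRecognitionRelEndNoLocalInclusion
import Summits.SmoothPoincare4.SmoothPoincare4.Theorems.SymplecticOrigamiGromovRecognitionRelEndRefMeetsHLeafOnce
import Summits.SmoothPoincare4.SmoothPoincare4.Theorems.SymplecticOrigamiGromovRecognitionRelEndEmbeddedLocalImage
import Summits.SmoothPoincare4.SmoothPoincare4.Theorems.SymplecticOrigamiGromovRecognitionRelEndOrientationSign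
import Summits.SmoothPoincare4.SmoothPoincare4.Theorems.SymplecticOrigamiGromovRecognitionRelEndSignConstantOnLeaf
import Summits.SmoothPoincare4.SmoothPoincare4.Theorems.SymplecticOrigamiGromovRecognitionRelEndLocalIndexSigned
import Summits.SmoothPoincare4.SmoothPoincare4.Theorems.SymplecticOrigamiGromovRecognitionRelEndJointAux
import Summits.SmoothPoincare4.SmoothPoincare4.Theorems.SymplecticOrigamiGromovRecognitionRelEndJointKey
import Literature.Geometry.Symplectic.JSphereLocalFoliation
import Literature.Geometry.Symplectic.PositivityOfIntersectionsLocal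
import Literature.Geometry.Symplectic.AdjunctionEmbeddedSpheres
import Literature.Geometry.Symplectic.JCurveIntersectionCountHomological
import Literature.Geometry.Symplectic.SphereIntersectionIndexHomological
import Literature.Topology.PlaneTopology.WindingNumber
import Mathlib

/-!
# The joint lemma of the bi-foliation: a `V`-leaf and an `H`-leaf meet exactly once, transversally
(registered helper `helper_joint` (L9) of line `cross-cap-laurent`, crux `GromovRecognitionRelEnd`,
item stmt-SmoothPoincare4-11009; generic lemmas in `…JointAux`, namespace `Joint`)

Proof.  `L = (u, v)` a `V`-leaf (glued map `F ~ F₀`), `L' = (u', v')` an `H`-leaf with FOLIATION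
COORDINATE `(N', π')` (`helper_leafCoordinate`: normal witness with `JX`-invariant kernels on the
open `N' ⊇ K' := pairImage u' v'`).  F6' (`sphere_zeroSetIndex_factorsThroughHomology`) on the
compact regular zero set `K'` gives an additive `c'` on `H₂(X; ℤ)` computing winding sums.  The
reference sphere `V∞` meets `L'` once, transversally (`helper_refMeetsHLeafOnce`), so
`ε · c' ((F₀)_*) = 1` with `ε = ±1` the orientation sign of `π'` (`helper_localIndexSigned`,
transverse case); `c' (F_*) = c' ((F₀)_*)` by homotopy invariance; `L` is nowhere locally inside
`L'` (`helper_noLocalInclusion` + `helper_leafClopen`), its meeting parameters are isolated and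
finite (`helper_isolatedMeetingFinite`) and contribute `ε · nᵢ`, `nᵢ ≥ 1`, `= 1` iff transverse,
with the SAME `ε` (`helper_signConstantOnLeaf`).  Hence exactly one meeting point, transverse.
-/

noncomputable section

open scoped Manifold ContDiff Topology
open Set Function Filter Literature.Topology.FourManifolds Literature.Topology.FourManifolds.ComplexProjectiveSpace
  Literature.Geometry.Kaehler Literature.Geometry.Symplectic Literature.AlgebraicTopology.SingularHomology
  Literature.Topology.PlaneTopology

-- the prescribed namespace `Summit.<P>.<Sub>.…` duplicates `SmoothPoincare4` (P = Sub)
set_option linter.dupNamespace false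

namespace Summit.SmoothPoincare4.SmoothPoincare4.Theorems.GromovRecognitionRelEnd.CrossCapLaurent



/-! ## The joint lemma -/

/-- **`helper_joint` (L9): a `V`-leaf and an `H`-leaf meet in exactly one point, transversally**
(positivity of intersections with the foliation coordinate of the `H`-leaf + the homological
winding sum; see the module docstring for the proof). -/
theorem helper_joint : ∀ (X : Type) [TopologicalSpace X] [T2Space X]
    [SecondCountableTopology X] [CompactSpace X] [ConnectedSpace X]
    [ChartedSpace (EuclideanSpace ℝ (Fin 4)) X] [IsManifold (𝓡 4) ∞ X] (ωX : MForm (𝓡 4) X ℝ 2)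
    (JX : AlmostComplexStructure (𝓡 4) ∞ X) (u₀ v₀ uH vH : ℂ → X)
    (F₀ FH : C(ComplexProjectiveSpace 1, X)) (TH TV : X → ℂ) (UH UV : Set X) (δ : ℝ),
    hls_localFoliation_embeddedSphere_trivialNormal → positivityOfIntersections_leafCoordinate →
    adjunction_embedded_of_somewhereInjective_sphere → jSphere_wedgeCount_factorsThroughHomology →
    sphere_zeroSetIndex_factorsThroughHomology →
    FoliationData ωX JX u₀ v₀ uH vH F₀ TH TV UH UV δ →
    FoliationData ωX JX uH vH u₀ v₀ FH TV TH UV UH δ →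
    ∀ (u v u' v' : ℂ → X), IsLeafOf (fun y => JX y) F₀ u v → IsLeafOf (fun y => JX y) FH u' v' →
    (∃ y : X, y ∈ pairImage u v ∧ y ∈ pairImage u' v') ∧
    (∀ y y' : X, y ∈ pairImage u v → y ∈ pairImage u' v' → y' ∈ pairImage u v →
      y' ∈ pairImage u' v' → y = y') ∧
    (∀ y : X, y ∈ pairImage u v → y ∈ pairImage u' v' → ∀ ξ : TangentSpace (𝓡 4) y,
      ((∃ z : ℂ, u z = y ∧ ξ ∈ range (mfderiv 𝓘(ℝ, ℂ) (𝓡 4) u z)) ∨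
        (v 0 = y ∧ ξ ∈ range (mfderiv 𝓘(ℝ, ℂ) (𝓡 4) v 0))) →
      ((∃ z' : ℂ, u' z' = y ∧ ξ ∈ range (mfderiv 𝓘(ℝ, ℂ) (𝓡 4) u' z')) ∨
        (v' 0 = y ∧ ξ ∈ range (mfderiv 𝓘(ℝ, ℂ) (𝓡 4) v' 0))) → ξ = 0) := by
  intro X _ _ _ _ _ _ _ ωX JX u₀ v₀ uH vH F₀ FH TH TV UH UV δ hF1 hF3 hF4 hF6 hF6' D D' u v u' v'
    hl hl'
  /- 1. The foliation coordinate of `L'` and the zero set `K' = pairImage u' v'`. -/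
  obtain ⟨N', π', hW, hJinv⟩ := helper_leafCoordinate X JX FH hF1 hF4 u' v' hl'
  have hKiff : ∀ y, (y ∈ N' ∧ π' y = 0) ↔ y ∈ pairImage u' v' := fun y => by
    simpa only [mem_setOf_eq, ← pairImage_eq] using Set.ext_iff.mp hW.zeroSet_eq y
  have hK'sub : pairImage u' v' ⊆ N' := by rw [pairImage_eq]; exact hW.image_subset
  have hK'closed : IsClosed (pairImage u' v') := (Joint.isCompact_pairImage hl'.sphere).isClosed
  have hK'cpt : IsCompact {y : X | y ∈ N' ∧ π' y = 0} := by
    rw [hW.zeroSet_eq, ← pairImage_eq]; exact Joint.isCompact_pairImage hl'.sphere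
  have hmem_u' : ∀ w, u' w ∈ N' ∧ π' (u' w) = 0 := fun w =>
    (hKiff _).2 ((mem_pairImage_iff _ _ _).2 (Or.inl ⟨w, rfl⟩))
  have hmem_v' : ∀ w, v' w ∈ N' ∧ π' (v' w) = 0 := fun w => by
    refine (hKiff _).2 ((mem_pairImage_iff _ _ _).2 ?_)
    by_cases hw : w = 0
    · exact Or.inr (by rw [hw])
    · exact Or.inl ⟨w⁻¹, (hl'.sphere.compat w hw).symm⟩
  have hkill : ∀ (y : X) (ξ : TangentSpace (𝓡 4) y),
      ((∃ z' : ℂ, u' z' = y ∧ ξ ∈ range (mfderiv 𝓘(ℝ, ℂ) (𝓡 4) u' z')) ∨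
        (v' 0 = y ∧ ξ ∈ range (mfderiv 𝓘(ℝ, ℂ) (𝓡 4) v' 0))) →
      mfderiv (𝓡 4) 𝓘(ℝ, ℂ) π' y ξ = 0 := by
    rintro y ξ (⟨z', rfl, ζ, rfl⟩ | ⟨rfl, ζ, rfl⟩)
    · exact Joint.mfderiv_apply_eq_zero_of_forall hW.isOpen hW.smooth hl'.sphere.smooth_u hmem_u' z' ζ
    · exact Joint.mfderiv_apply_eq_zero_of_forall hW.isOpen hW.smooth hl'.sphere.smooth_v hmem_v' 0 ζ
  /- 2. The reference point `q = V∞ ∩ L'` and the sign `ε`. -/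
  obtain ⟨q, hqV, hqK, hquniq, hqtrans⟩ :=
    helper_refMeetsHLeafOnce X ωX JX u₀ v₀ uH vH F₀ FH TH TV UH UV δ hF6 D D' u' v' hl'
  have hqN : q ∈ N' := hK'sub hqK
  obtain ⟨ξq, hξq⟩ := hW.submersive q hqN (1 : ℂ)
  set ε : ℤ := if 0 < (show ℂ from mfderiv (𝓡 4) 𝓘(ℝ, ℂ) π' q (JX q ξq)).im then 1 else -1
    with hε
  /- 3. KEY: the signed local index of any smooth `JX`-holomorphic `p` at a meeting parameter. -/
  have key : ∀ (p : ℂ → X) (z : ℂ), ContMDiff 𝓘(ℝ, ℂ) (𝓡 4) ∞ p →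
      IsJHolomorphic (𝓡 4) (fun y => JX y) p → p z ∈ pairImage u' v' →
      (∀ᶠ w in 𝓝 z, p w ∈ pairImage u' v') ∨
      (∃ r₀ : ℝ, 0 < r₀ ∧
        (∀ w : ℂ, 0 < ‖w - z‖ → ‖w - z‖ ≤ r₀ → p w ∈ N' ∧ p w ∉ pairImage u' v') ∧
        ∀ r : ℝ, 0 < r → r ≤ r₀ →
          1 ≤ ε * wind (fun t => π' (p (circleLoop z r t))) ∧
          (ε * wind (fun t => π' (p (circleLoop z r t))) = 1 ↔
            Surjective (mfderiv 𝓘(ℝ, ℂ) 𝓘(ℝ, ℂ) (π' ∘ p) z))) := by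
    intro p z hp hJp hpz
    have h := helper_jointSignedIndex X JX FH u' v' N' π' q ξq p z hF3 hl' hW hJinv hqK hξq hp hJp hpz
    rw [← hε] at h
    exact h
  /- 4. The `V`-leaf is nowhere locally inside `L'`; isolated meetings; finiteness. -/
  have hnot : ¬ (pairImage u v ⊆ pairImage u' v') :=
    helper_noLocalInclusion X ωX JX u₀ v₀ uH vH F₀ FH TH TV UH UV δ hF1 hF6 D D' u v u' v' hl hl'
  have key_u := fun z => key u z hl.sphere.smooth_u hl.sphere.hol_u
  have key_v := fun z => key v z hl.sphere.smooth_v hl.sphere.hol_v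
  have dich_u : ∀ z, u z ∈ pairImage u' v' →
      (∀ᶠ w in 𝓝 z, u w ∈ pairImage u' v') ∨ (∀ᶠ w in 𝓝[≠] z, u w ∉ pairImage u' v') := by
    intro z hz
    rcases key_u z hz with h | ⟨r₀, hr₀, hpunct, -⟩
    · exact Or.inl h
    · exact Or.inr (Joint.eventually_nhdsNE_of_punctured hr₀ fun w h1 h2 => (hpunct w h1 h2).2)
  have dich_v : ∀ z, v z ∈ pairImage u' v' →
      (∀ᶠ w in 𝓝 z, v w ∈ pairImage u' v') ∨ (∀ᶠ w in 𝓝[≠] z, v w ∉ pairImage u' v') := by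
    intro z hz
    rcases key_v z hz with h | ⟨r₀, hr₀, hpunct, -⟩
    · exact Or.inl h
    · exact Or.inr (Joint.eventually_nhdsNE_of_punctured hr₀ fun w h1 h2 => (hpunct w h1 h2).2)
  have no1_u : ∀ z, ¬ (∀ᶠ w in 𝓝 z, u w ∈ pairImage u' v') := by
    intro z hz
    have hall := helper_leafClopen X u (pairImage u' v') hl.sphere.smooth_u.continuous hK'closed
      dich_u ⟨z, hz⟩
    refine hnot fun y hy => ?_
    rcases (mem_pairImage_iff _ _ _).1 hy with ⟨w, rfl⟩ | rfl
    · exact hall w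
    · exact Joint.apply_zero_mem_of_isClosed hK'closed hl.sphere.smooth_v.continuous fun w hw => by
        rw [hl.sphere.compat w hw]; exact hall _
  have no1_v : ∀ w, ¬ (∀ᶠ w' in 𝓝 w, v w' ∈ pairImage u' v') := by
    intro w hw
    have hall := helper_leafClopen X v (pairImage u' v') hl.sphere.smooth_v.continuous hK'closed
      dich_v ⟨w, hw⟩
    have hu_of : ∀ z : ℂ, z ≠ 0 → u z ∈ pairImage u' v' := fun z hz => by
      have h := hl.sphere.compat z⁻¹ (inv_ne_zero hz)
      rw [inv_inv] at h
      rw [← h]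
      exact hall _
    refine hnot fun y hy => ?_
    rcases (mem_pairImage_iff _ _ _).1 hy with ⟨z, rfl⟩ | rfl
    · by_cases hz : z = 0
      · subst hz
        exact Joint.apply_zero_mem_of_isClosed hK'closed hl.sphere.smooth_u.continuous hu_of
      · exact hu_of z hz
    · exact hall 0
  have alt2_u : ∀ z, u z ∈ pairImage u' v' → ∃ r₀ : ℝ, 0 < r₀ ∧
      (∀ w : ℂ, 0 < ‖w - z‖ → ‖w - z‖ ≤ r₀ → u w ∈ N' ∧ u w ∉ pairImage u' v') ∧
      ∀ r : ℝ, 0 < r → r ≤ r₀ →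
        1 ≤ ε * wind (fun t => π' (u (circleLoop z r t))) ∧
        (ε * wind (fun t => π' (u (circleLoop z r t))) = 1 ↔
          Surjective (mfderiv 𝓘(ℝ, ℂ) 𝓘(ℝ, ℂ) (π' ∘ u) z)) :=
    fun z hz => (key_u z hz).resolve_left (no1_u z)
  have alt2_v := fun (hv0 : v 0 ∈ pairImage u' v') => (key_v 0 hv0).resolve_left (no1_v 0)
  have hfin : {z : ℂ | u z ∈ pairImage u' v'}.Finite :=
    helper_isolatedMeetingFinite X u v (pairImage u' v') hl.sphere.smooth_u.continuous
      hl.sphere.smooth_v.continuous hl.sphere.compat hK'closed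
      (fun z hz => by
        obtain ⟨r₀, hr₀, hpunct, -⟩ := alt2_u z hz
        exact Joint.eventually_nhdsNE_of_punctured hr₀ fun w h1 h2 => (hpunct w h1 h2).2)
      (fun h0 => by
        obtain ⟨r₀, hr₀, hpunct, -⟩ := alt2_v h0
        exact Joint.eventually_nhdsNE_of_punctured hr₀ fun w h1 h2 => (hpunct w h1 h2).2)
  /- 5. The homological functional `c'` of `K'`. -/
  obtain ⟨c', hc'⟩ := hF6' X JX π' N' hW.isOpen hW.smooth hW.submersive hK'cpt
  have hSet : ∀ p : ℂ → X, {z : ℂ | p z ∈ N' ∧ π' (p z) = 0} = {z | p z ∈ pairImage u' v'} :=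
    fun p => Set.ext fun z => hKiff (p z)
  have hSet0 : ∀ p : ℂ → X,
      {w : ℂ | w = 0 ∧ p w ∈ N' ∧ π' (p w) = 0} = {w | w = 0 ∧ p w ∈ pairImage u' v'} :=
    fun p => Set.ext fun w => and_congr_right fun _ => hKiff (p w)
  /- 6. The reference sphere: `ε * c' ((F₀)_*) = 1`. -/
  have memV : ∀ z, u₀ z ∈ pairImage u₀ v₀ := fun z => (mem_pairImage_iff _ _ _).2 (Or.inl ⟨z, rfl⟩)
  have memV0 : v₀ 0 ∈ pairImage u₀ v₀ := (mem_pairImage_iff _ _ _).2 (Or.inr rfl)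
  have hfin₀ : {z : ℂ | u₀ z ∈ N' ∧ π' (u₀ z) = 0}.Finite := by
    rw [hSet]
    refine Set.Subsingleton.finite fun z hz z' hz' => D.ref_embedded.injective ?_
    exact (hquniq _ (memV z) hz).trans (hquniq _ (memV z') hz').symm
  obtain ⟨r₁, hr₁, H₁⟩ := hc' u₀ v₀ F₀ D.ref_sphere.smooth_u D.ref_sphere.smooth_v
    D.ref_sphere.compat D.ref_glued.chart_zero D.ref_glued.chart_one hfin₀
  have hqkill : ∀ ξ : TangentSpace (𝓡 4) q,
      ((∃ z : ℂ, u₀ z = q ∧ ξ ∈ range (mfderiv 𝓘(ℝ, ℂ) (𝓡 4) u₀ z)) ∨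
        (v₀ 0 = q ∧ ξ ∈ range (mfderiv 𝓘(ℝ, ℂ) (𝓡 4) v₀ 0))) →
      mfderiv (𝓡 4) 𝓘(ℝ, ℂ) π' q ξ = 0 → ξ = 0 := by
    intro ξ hξV hξ0
    refine hqtrans ξ hξV ?_
    rcases (mem_pairImage_iff _ _ _).1 hqK with ⟨z', hz'⟩ | hqv'
    · refine Or.inl ⟨z', hz', Joint.mem_range_of_apply_eq_zero _ _ (hW.submersive q hqN)
        (hl'.embedded.imm_u z') (fun ζ => ?_) hξ0⟩
      rw [← hz']
      exact Joint.mfderiv_apply_eq_zero_of_forall hW.isOpen hW.smooth hl'.sphere.smooth_u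
        hmem_u' z' ζ
    · refine Or.inr ⟨hqv'.symm, Joint.mem_range_of_apply_eq_zero _ _ (hW.submersive q hqN)
        hl'.embedded.imm_v (fun ζ => ?_) hξ0⟩
      rw [hqv']
      exact Joint.mfderiv_apply_eq_zero_of_forall hW.isOpen hW.smooth hl'.sphere.smooth_v
        hmem_v' 0 ζ
  have href : ε * c' (singularHomology.map ℤ ℤ F₀ (2 * 1)
      (ComplexProjectiveSpace.homologicalOrientationInt 1).fundamentalClass) = 1 := by
    rcases (mem_pairImage_iff u₀ v₀ q).1 hqV with ⟨w, hw⟩ | hqv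
    · -- affine meeting point `q = u₀ w`
      have hwK : u₀ w ∈ pairImage u' v' := hw ▸ hqK
      have hnot1 : ¬ ∀ᶠ w' in 𝓝 w, u₀ w' ∈ pairImage u' v' := by
        intro h
        obtain ⟨w', hw'K, hne⟩ :=
          ((eventually_nhdsWithin_of_eventually_nhds h).and self_mem_nhdsWithin).exists (f := 𝓝[≠] w)
        exact hne (D.ref_embedded.injective ((hquniq _ (memV w') hw'K).trans hw.symm))
      obtain ⟨ρ, hρ, -, Hρ⟩ :=
        (key u₀ w D.ref_sphere.smooth_u D.ref_sphere.hol_u hwK).resolve_left hnot1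
      have hsurj : Surjective (mfderiv 𝓘(ℝ, ℂ) 𝓘(ℝ, ℂ) (π' ∘ u₀) w) := by
        refine Joint.surjective_mfderiv_comp hW.isOpen hW.smooth D.ref_sphere.smooth_u (hK'sub hwK)
          (by rw [hw]; exact hW.submersive q hqN) (D.ref_embedded.imm_u w) fun ζ hζ => ?_
        exact D.ref_embedded.imm_u w
          ((hqkill _ (Or.inl ⟨w, hw, ζ, rfl⟩) (by rw [← hw]; exact hζ)).trans (map_zero _).symm)
      have hS1 : {z : ℂ | u₀ z ∈ N' ∧ π' (u₀ z) = 0} = {w} := by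
        rw [hSet]
        ext z
        simp only [mem_setOf_eq, mem_singleton_iff]
        exact ⟨fun hz => D.ref_embedded.injective ((hquniq _ (memV z) hz).trans hw.symm),
          fun hz => hz ▸ hwK⟩
      have hS2 : {w' : ℂ | w' = 0 ∧ v₀ w' ∈ N' ∧ π' (v₀ w') = 0} = ∅ := by
        rw [hSet0]
        ext w'
        simp only [mem_setOf_eq, mem_empty_iff_false, iff_false, not_and]
        rintro rfl h0
        exact D.ref_embedded.infty_notMem ⟨w, hw.trans (hquniq _ memV0 h0).symm⟩
      have h := H₁ (min ρ r₁) (lt_min hρ hr₁) (min_le_right _ _)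
      rw [hS1, hS2, finsum_mem_singleton, finsum_mem_empty, add_zero] at h
      rw [h]
      exact (Hρ (min ρ r₁) (lt_min hρ hr₁) (min_le_left _ _)).2.2 hsurj
    · -- the corner `q = v₀ 0`
      have h0K : v₀ 0 ∈ pairImage u' v' := hqv ▸ hqK
      have hnot1 : ¬ ∀ᶠ w' in 𝓝 (0 : ℂ), v₀ w' ∈ pairImage u' v' := by
        intro h
        obtain ⟨w', hw'K, hne⟩ :=
          ((eventually_nhdsWithin_of_eventually_nhds h).and self_mem_nhdsWithin).exists (f := 𝓝[≠] (0 : ℂ))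
        have h1 : v₀ w' = u₀ w'⁻¹ := D.ref_sphere.compat w' hne
        have h2 : v₀ w' = q := hquniq _ (h1 ▸ memV w'⁻¹) hw'K
        exact D.ref_embedded.infty_notMem ⟨w'⁻¹, by rw [← h1, h2, hqv]⟩
      obtain ⟨ρ, hρ, -, Hρ⟩ :=
        (key v₀ 0 D.ref_sphere.smooth_v D.ref_sphere.hol_v h0K).resolve_left hnot1
      have hsurj : Surjective (mfderiv 𝓘(ℝ, ℂ) 𝓘(ℝ, ℂ) (π' ∘ v₀) 0) := by
        refine Joint.surjective_mfderiv_comp hW.isOpen hW.smooth D.ref_sphere.smooth_v (hK'sub h0K)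
          (by rw [← hqv]; exact hW.submersive q hqN) D.ref_embedded.imm_v fun ζ hζ => ?_
        exact D.ref_embedded.imm_v
          ((hqkill _ (Or.inr ⟨hqv.symm, ζ, rfl⟩) (by rw [hqv]; exact hζ)).trans (map_zero _).symm)
      have hS1 : {z : ℂ | u₀ z ∈ N' ∧ π' (u₀ z) = 0} = ∅ := by
        rw [hSet]
        ext z
        simp only [mem_setOf_eq, mem_empty_iff_false, iff_false]
        intro hz
        exact D.ref_embedded.infty_notMem ⟨z, (hquniq _ (memV z) hz).trans hqv⟩
      have hS2 : {w' : ℂ | w' = 0 ∧ v₀ w' ∈ N' ∧ π' (v₀ w') = 0} = {0} := by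
        rw [hSet0]
        ext w'
        simp only [mem_setOf_eq, mem_singleton_iff]
        exact ⟨fun h => h.1, fun h => ⟨h, h ▸ h0K⟩⟩
      have h := H₁ (min ρ r₁) (lt_min hρ hr₁) (min_le_right _ _)
      rw [hS1, hS2, finsum_mem_empty, finsum_mem_singleton, zero_add] at h
      rw [h]
      exact (Hρ (min ρ r₁) (lt_min hρ hr₁) (min_le_left _ _)).2.2 hsurj
  /- 7. The leaf: `ε * c' (F_*) = 1`, and the sum over the meeting parameters. -/
  haveI hdec : Decidable (v 0 ∈ pairImage u' v') := Classical.dec _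
  obtain ⟨F, hF, hhom⟩ := hl.glued
  have hfinF : {z : ℂ | u z ∈ N' ∧ π' (u z) = 0}.Finite := by rw [hSet]; exact hfin
  obtain ⟨r₂, hr₂, H₂⟩ := hc' u v F hl.sphere.smooth_u hl.sphere.smooth_v hl.sphere.compat
    hF.chart_zero hF.chart_one hfinF
  have hcF : ε * c' (singularHomology.map ℤ ℤ F (2 * 1)
      (ComplexProjectiveSpace.homologicalOrientationInt 1).fundamentalClass) = 1 := by
    rw [singularHomology.map_eq_of_homotopic ℤ ℤ hhom (2 * 1)]
    exact href
  choose! ρ hρpos hρpunct hρwind using alt2_u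
  obtain ⟨r₃, hr₃, hr₃le⟩ := Joint.exists_pos_le_of_finite hfin ρ fun z hz => hρpos z hz
  obtain ⟨ρv, hρv, Hv⟩ : ∃ ρv : ℝ, 0 < ρv ∧ (v 0 ∈ pairImage u' v' → ∀ r : ℝ, 0 < r → r ≤ ρv →
      1 ≤ ε * wind (fun t => π' (v (circleLoop 0 r t))) ∧
      (ε * wind (fun t => π' (v (circleLoop 0 r t))) = 1 ↔
        Surjective (mfderiv 𝓘(ℝ, ℂ) 𝓘(ℝ, ℂ) (π' ∘ v) 0))) := by
    by_cases hv0 : v 0 ∈ pairImage u' v'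
    · obtain ⟨r₀, hr₀, -, H⟩ := alt2_v hv0
      exact ⟨r₀, hr₀, fun _ => H⟩
    · exact ⟨1, one_pos, fun h => (hv0 h).elim⟩
  set r : ℝ := min r₂ (min r₃ ρv) with hr_def
  have hr : 0 < r := lt_min hr₂ (lt_min hr₃ hρv)
  have hrρ : ∀ z, u z ∈ pairImage u' v' → r ≤ ρ z := fun z hz =>
    ((min_le_right _ _).trans (min_le_left _ _)).trans (hr₃le z hz)
  have hrρv : r ≤ ρv := (min_le_right _ _).trans (min_le_right _ _)
  have Hsum := H₂ r hr (min_le_left _ _)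
  rw [hSet, hSet0, finsum_mem_eq_finite_toFinset_sum _ hfin] at Hsum
  have hV' : {w : ℂ | w = 0 ∧ v w ∈ pairImage u' v'} =
      if v 0 ∈ pairImage u' v' then {0} else ∅ := by
    split_ifs with h
    · ext w
      simp only [mem_setOf_eq, mem_singleton_iff]
      exact ⟨fun hw => hw.1, fun hw => ⟨hw, hw ▸ h⟩⟩
    · ext w
      simp only [mem_setOf_eq, mem_empty_iff_false, iff_false, not_and]
      rintro rfl
      exact h
  have hterm : (∑ᶠ w ∈ {w : ℂ | w = 0 ∧ v w ∈ pairImage u' v'},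
      wind (fun t => π' (v (circleLoop w r t)))) =
      if v 0 ∈ pairImage u' v' then wind (fun t => π' (v (circleLoop 0 r t))) else 0 := by
    rw [hV']
    split_ifs
    · exact finsum_mem_singleton
    · exact finsum_mem_empty
  rw [hterm] at Hsum
  have hmain : (hfin.toFinset.sum fun z => ε * wind (fun t => π' (u (circleLoop z r t)))) +
      (if v 0 ∈ pairImage u' v' then ε * wind (fun t => π' (v (circleLoop 0 r t))) else 0) = 1 := by
    rw [← Finset.mul_sum]
    have h : (if v 0 ∈ pairImage u' v' then ε * wind (fun t => π' (v (circleLoop 0 r t))) else 0) =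
        ε * (if v 0 ∈ pairImage u' v' then wind (fun t => π' (v (circleLoop 0 r t))) else 0) := by
      split_ifs <;> simp
    rw [h, ← mul_add, ← Hsum]
    exact hcF
  have hstruct := Joint.sum_eq_one_structure (s := hfin.toFinset)
    (f := fun z => ε * wind (fun t => π' (u (circleLoop z r t))))
    (b := ε * wind (fun t => π' (v (circleLoop 0 r t)))) (P := v 0 ∈ pairImage u' v')
    (fun z hz => (hρwind z (hfin.mem_toFinset.1 hz) r hr (hrρ z (hfin.mem_toFinset.1 hz))).1)
    (fun h0 => (Hv h0 r hr hrρv).1) hmain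
  /- 8. Conclusions. -/
  have memL : ∀ z, u z ∈ pairImage u v := fun z => (mem_pairImage_iff _ _ _).2 (Or.inl ⟨z, rfl⟩)
  have memL0 : v 0 ∈ pairImage u v := (mem_pairImage_iff _ _ _).2 (Or.inr rfl)
  rcases hstruct with ⟨z₀, hs, hz₀1, hv0⟩ | ⟨hs, hv0, hb⟩
  · -- exactly one affine meeting parameter `z₀`, none at infinity
    have hz₀K : u z₀ ∈ pairImage u' v' := hfin.mem_toFinset.1 (by rw [hs]; exact Finset.mem_singleton_self _)
    have honly : ∀ y, y ∈ pairImage u v → y ∈ pairImage u' v' → y = u z₀ := by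
      intro y hy hyK
      rcases (mem_pairImage_iff _ _ _).1 hy with ⟨z, rfl⟩ | rfl
      · have hz : z ∈ hfin.toFinset := hfin.mem_toFinset.2 hyK
        rw [hs, Finset.mem_singleton] at hz
        rw [hz]
      · exact (hv0 hyK).elim
    have hsurj : Surjective (mfderiv 𝓘(ℝ, ℂ) 𝓘(ℝ, ℂ) (π' ∘ u) z₀) :=
      (hρwind z₀ hz₀K r hr (hrρ z₀ hz₀K)).2.1 hz₀1
    refine ⟨⟨u z₀, memL z₀, hz₀K⟩, fun y y' hy hyK hy' hy'K =>
      (honly y hy hyK).trans (honly y' hy' hy'K).symm, fun y hy hyK ξ hξL hξL' => ?_⟩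
    have hy0 := honly y hy hyK
    subst hy0
    rcases hξL with ⟨z₁, hz₁, ζ, rfl⟩ | ⟨hv, ζ, rfl⟩
    · have hzz : z₁ = z₀ := hl.embedded.injective hz₁
      subst hzz
      have h0 := hkill _ _ hξL'
      have hζ := Joint.eq_zero_of_surjective_mfderiv_comp hW.isOpen hW.smooth hl.sphere.smooth_u
        (hK'sub hz₀K) (hW.submersive _ (hK'sub hz₀K)) (hl.embedded.imm_u _) hsurj h0
      rw [hζ]
      exact map_zero _
    · exact (hl.embedded.infty_notMem ⟨z₀, hv.symm⟩).elim
  · -- no affine meeting parameter, the point at infinity `v 0` meets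
    have honly : ∀ y, y ∈ pairImage u v → y ∈ pairImage u' v' → y = v 0 := by
      intro y hy hyK
      rcases (mem_pairImage_iff _ _ _).1 hy with ⟨z, rfl⟩ | rfl
      · have hz : z ∈ hfin.toFinset := hfin.mem_toFinset.2 hyK
        rw [hs] at hz
        exact (Finset.notMem_empty _ hz).elim
      · rfl
    have hsurj : Surjective (mfderiv 𝓘(ℝ, ℂ) 𝓘(ℝ, ℂ) (π' ∘ v) 0) := (Hv hv0 r hr hrρv).2.1 hb
    refine ⟨⟨v 0, memL0, hv0⟩, fun y y' hy hyK hy' hy'K =>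
      (honly y hy hyK).trans (honly y' hy' hy'K).symm, fun y hy hyK ξ hξL hξL' => ?_⟩
    have hy0 := honly y hy hyK
    subst hy0
    rcases hξL with ⟨z₁, hz₁, ζ, rfl⟩ | ⟨-, ζ, rfl⟩
    · exact (hl.embedded.infty_notMem ⟨z₁, hz₁⟩).elim
    · have h0 := hkill _ _ hξL'
      have hζ := Joint.eq_zero_of_surjective_mfderiv_comp hW.isOpen hW.smooth hl.sphere.smooth_v
        (hK'sub hv0) (hW.submersive _ (hK'sub hv0)) hl.embedded.imm_v hsurj h0
      rw [hζ]
      exact map_zero _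

end Summit.SmoothPoincare4.SmoothPoincare4.Theorems.GromovRecognitionRelEnd.CrossCapLaurent

end
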